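import Summits.HodgeConjecture.HodgeConjecture.Theorems.FirstOrderSemiregularSeedsFirstOrderWeilSeedsEightCPad4Anchor
import Summits.HodgeConjecture.HodgeConjecture.Theorems.Ring2SemiregularRepresentativesVHC
import Literature.AlgebraicGeometry.HodgeTheory.ChernCharacterBettiSums
import Literature.AlgebraicGeometry.Modules.SerreSubbundleOfTwists
import Mathlib.LinearAlgebra.Vandermonde
import Mathlib.LinearAlgebra.Matrix.NonsingularInverse
import HarnessLib

/-!
# Route `FirstOrderSemiregularSeeds`, crux X2′ `FirstOrderWeilSeedsEightC` (item stmt-HodgeConjecture-23714), line `birthC` v2: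
# the DESIGN-ONLY class-half stub `stub_lfDesign_pad4`, MODULO Serre's theorem A (sub-bundle form) ONLY

HONEST FRAMING. Nothing here proves X2′, X1, rung H2, HC for abelian varieties or the Hodge conjecture. CONDITIONAL
`--supports` helper for the registered stub `stub_lfDesign_pad4` (hence, by the skeleton's `kappaDesign_pad4_of_lfDesign`,
for `stub_kappaDesign_pad4`) of `Cruxes/FirstOrderWeilSeedsEight/Lines/birthC.lean` v2; the only input not proved in the tree
is the Chern-character-FREE named fact `Literature.AlgebraicGeometry.Modules.Hartshorne1977_serre_subbundleOfTwists`
(Hartshorne II Thm. 5.17: a finite locally free `E` on `X ↪ ℙⁿ` sits in a short exact sequence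
`0 → E → (e^*L₀)^{⊞(k+1)} → Q → 0`, `L₀` rank `≤ 1` on `ℙⁿ`, `Q` finite locally free). This executes the lead's
`STUB-PLAN-stub_kappaDesign_pad4.md` (revision 2, axioms-only recipe) for EVERY `C : ChernCharacterBetti`:

1. `w` (a non-zero rational `(4,4)` Weil class on the pinned anchor `S⁴`) is ALGEBRAIC (`pad4Anchor_hodgeClass_mem_algebraicClasses`);
2. SPAN + rational descent (`ChernCharacterBetti.exists_rat_combination_of_mem_algebraicClasses`): `w = Σᵢ qᵢ·ch₄(Eᵢ)`,
   `qᵢ ∈ ℚ`, `Eᵢ` vector bundles;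
3. PURIFY (`ChernCharacterBetti.ch_pullback_nsmul_id`: `ch_p([m]^*E) = m^{2p}·ch_p(E)`, and the Vandermonde coefficients
   `Σ_j s_j (j+1)^{2p} = δ_{p,4}`, `p ≤ 8`, `exists_rat_vandermonde_delta`): the virtual class
   `y = Σ_{j,i} s_j qᵢ·[[j+1]^*Eᵢ]` has `ch_p(y) = δ_{p,4}·w` for `p ≤ 8`; clearing denominators `N·y = [E₊] - [E₋]` with
   `E±` list-indexed direct sums of the `[j+1]^*Eᵢ` (`isFiniteLocallyFree_foldr_biprod`, `ch_foldr_biprod`);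
4. SERRE (the named fact, with the `K`-symmetrised re-embedding `e_K`, `e_K^*a_K = μ·h_K`,
   `exists_projectiveEmbedding_symmetrised`): `0 → E₋ → F → Q → 0`, `F = (e_K^*L₀)^{⊞(k+1)}`, so by ADDITIVITY
   `ch(Q) = ch(F) - ch(E₋)` with `ch_p(F) ∈ ℚ·h_Kᵖ` (`ch_p(L₀) = ch₁(L₀)ᵖ/p!`, `ch₁(L₀) ∈ ℚ·a_K` on the line `H²(ℙⁿ(ℂ); ℂ)`,
   `ch₀ ∈ ℚ·1` on the path-connected `S⁴(ℂ)`);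
5. `E₀ := E₊ ⊞ Q` is finite locally free with `ch_p(E₀) = c_p·h_Kᵖ` (`p ≠ 4`, `p ≤ 8`) and `ch₄(E₀) = c₄·h_K⁴ + N·w`:
   `HasSeedOn 𝒪 4 S⁴ h_K (N·w)` for every object class `𝒪` containing the f.l.f. κ-designs (the skeleton's `lfDesignClass C`).

The skeleton obtains `stub_lfDesign_pad4` by
`fun C d hd E₀ ψ₀ hE hψ e a w ha ha0 _ hwW hwQ hwH hw0 ↦ lfDesign_pad4_of_serre hS C (lfDesignClass C)
(fun _ _ _ h₁ h₂ h₃ ↦ ⟨h₁, h₂, h₃⟩) hd hE hψ (pad4Action E₀ ψ₀) rfl e a w ha ha0 hwW hwQ hwH hw0` once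
`hS : Hartshorne1977_serre_subbundleOfTwists` is a hypothesis (stub) of the line.

## References

[cite: Fulton1998, Example 3.2.3, §15.1, Example 15.2.16 (b)] [cite: Hartshorne1977, II Thm. 5.17 and Cor. 5.18]
[cite: MumfordAV1970, §1 (3)] [cite: vanGeemen1994HodgeAV, 4.3 and 5.3] [cite: Markman2025SurveySecant, §11.5 Step 2]
-/

noncomputable section

-- single-problem summit (Problem = Summit): the mandated namespace repeats `HodgeConjecture`.
set_option linter.dupNamespace false

open CategoryTheory CategoryTheory.Limits AlgebraicGeometry
open Literature.AlgebraicGeometry Literature.AlgebraicGeometry.Motives Literature.AlgebraicGeometry.HodgeTheory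
open Literature.AlgebraicTopology.SingularHomology
open Literature.AlgebraicGeometry.Modules (Hartshorne1977_serre_subbundleOfTwists isFiniteLocallyFree_of_isVectorBundle)
open Summit.Ventures.HSemireg

namespace Summit.HodgeConjecture.HodgeConjecture.Theorems

/-! ## §0 Arithmetic bookkeeping -/

section Bookkeeping

/-- The sum of `f` over a `flatMap` of `replicate`s: `Σ_{x ∈ l.flatMap (u ↦ replicate (n u) (M u))} f x = Σ_{u ∈ l} n u • f (M u)`. -/
theorem sum_map_flatMap_replicate {α β : Type*} [AddCommMonoid β] (f : α → β) {ι : Type*} (n : ι → ℕ) (M : ι → α)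
    (l : List ι) : ((l.flatMap fun u ↦ List.replicate (n u) (M u)).map f).sum = (l.map fun u ↦ n u • f (M u)).sum := by
  induction l with
  | nil => simp
  | cons u l ih => simp [List.flatMap_cons, List.sum_append, ih, List.map_replicate, List.sum_replicate]

/-- **Purifying coefficients** (Vandermonde at the distinct nodes `1², 2², …, n²`): rationals `s₀, …, s_{n-1}` with
`Σ_j s_j·(j+1)^{2p} = δ_{p,p₀}` for every `p < n`. -/
theorem exists_rat_vandermonde_delta (n p₀ : ℕ) :
    ∃ s : Fin n → ℚ, ∀ p : Fin n, ∑ j, s j * ((j : ℚ) + 1) ^ (2 * (p : ℕ)) = if (p : ℕ) = p₀ then 1 else 0 := by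
  classical
  let v : Fin n → ℚ := fun j ↦ ((j : ℚ) + 1) ^ 2
  have hv : Function.Injective v := by
    intro i j h
    have h' : ((i : ℚ) + 1) ^ 2 = ((j : ℚ) + 1) ^ 2 := h
    have hi : (0 : ℚ) ≤ (i : ℚ) + 1 := by positivity
    have hj : (0 : ℚ) ≤ (j : ℚ) + 1 := by positivity
    have := (pow_left_inj₀ hi hj two_ne_zero).1 h'
    exact Fin.ext (by exact_mod_cast (add_right_cancel this : (i : ℚ) = j))
  obtain ⟨M, hM⟩ : ∃ M : Matrix (Fin n) (Fin n) ℚ, M = (Matrix.vandermonde v).transpose := ⟨_, rfl⟩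
  have hMe : ∀ p j : Fin n, M p j = ((j : ℚ) + 1) ^ (2 * (p : ℕ)) := fun p j ↦ by
    rw [hM, Matrix.transpose_apply, Matrix.vandermonde_apply, ← pow_mul]
  have hMdet : IsUnit M.det := by
    rw [hM, Matrix.det_transpose, isUnit_iff_ne_zero, Matrix.det_vandermonde_ne_zero_iff]
    exact hv
  let b : Fin n → ℚ := fun p ↦ if (p : ℕ) = p₀ then 1 else 0
  refine ⟨M⁻¹.mulVec b, fun p ↦ ?_⟩
  have h2 : (M.mulVec (M⁻¹.mulVec b)) p = b p := by
    rw [Matrix.mulVec_mulVec, Matrix.mul_nonsing_inv M hMdet, Matrix.one_mulVec]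
  rw [Matrix.mulVec, dotProduct] at h2
  calc ∑ j, M⁻¹.mulVec b j * ((j : ℚ) + 1) ^ (2 * (p : ℕ)) = ∑ j, M p j * M⁻¹.mulVec b j :=
        Finset.sum_congr rfl fun j _ ↦ by rw [hMe, mul_comm]
    _ = b p := h2
    _ = if (p : ℕ) = p₀ then 1 else 0 := rfl

/-- Clearing denominators of finitely many rationals: a positive integer `N` with `N·a u ∈ ℤ` for all `u`. -/
theorem exists_nat_mul_eq_intCast {ι : Type*} [Fintype ι] (a : ι → ℚ) :
    ∃ (N : ℕ) (z : ι → ℤ), 0 < N ∧ ∀ u, ((z u : ℤ) : ℚ) = (N : ℚ) * a u := by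
  classical
  refine ⟨∏ u, (a u).den, fun u ↦ (∏ u' ∈ Finset.univ.erase u, ((a u').den : ℤ)) * (a u).num,
    Finset.prod_pos fun u _ ↦ (a u).den_pos, fun u ↦ ?_⟩
  rw [← Finset.prod_erase_mul _ _ (Finset.mem_univ u)]
  push_cast
  rw [mul_assoc, Rat.den_mul_eq_num]

/-- `n.toNat - (-n).toNat = n` read in a module: `(z.toNat : ℕ) • x - ((-z).toNat : ℕ) • x = (z : ℤ) • x`. -/
theorem toNat_smul_sub_neg_toNat_smul {M : Type*} [AddCommGroup M] (z : ℤ) (x : M) :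
    (z.toNat : ℕ) • x - ((-z).toNat : ℕ) • x = z • x := by
  rw [← natCast_zsmul, ← natCast_zsmul, ← sub_smul, Int.toNat_sub_toNat_neg]

end Bookkeeping

/-! ## §1 Seeds from ALGEBRAIC Weil classes on any abelian `2n`-fold, MODULO Serre's sub-bundle theorem -/

section Design

open Literature.AlgebraicGeometry.Motives.SegreHyperplaneClass in
/-- **An ALGEBRAIC rational class on a complex abelian `2n`-fold is carried, up to a positive multiple and modulo `ℚ[h_K]`,
by ONE finite locally free module — for EVERY Chern character theory `C`, MODULO `Hartshorne1977_serre_subbundleOfTwists`**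
(CONDITIONAL on that Chern-character-free named fact ONLY). Data: `P` with `dim P = 2n`, `Ψ ≫ Ψ = -(d • 𝟙)` (`d ≥ 1`), a
projective embedding `e` with a rational `a ≠ 0`, `h_K = d·e^*a + Ψ^*e^*a`, and a rational class `w ∈ weilClassesOf P Ψ n d`,
`w ≠ 0`, which is ALGEBRAIC. Conclusion: for every object class `𝒪` containing the finite-locally-free κ-designs of `C` in
relative dimension `2n`, some `N·w` (`N ≥ 1`) has an `𝒪`-seed: a finite locally free `E` with `ch_p(E) = c_p·h_Kᵖ`
(`p ≠ n`, `p ≤ 2n`) and `ch_n(E) = c_n·h_Kⁿ + N·w`. Proof (the lead's axioms-only recipe, steps 2–5 of the module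
docstring): SPAN with rational coefficients; Vandermonde purification along the isogenies `[1], …, [2n+1]`
(`ch_p([m]^*E) = m^{2p}·ch_p(E)`); integer multiplicities and the list-indexed direct sums `E±`; Serre's complement of `E₋`
after the `K`-symmetrised re-embedding (`e_K^*a_K = μ·h_K`), whose ambient `(e_K^*L₀)^{⊞(k+1)}` has `ch_p ∈ ℚ·h_Kᵖ`
(line-bundle exponential on `ℙⁿ`, `ch₁(L₀) ∈ ℚ·a_K` on the line `H²(ℙⁿ(ℂ); ℂ)`, `ch₀ ∈ ℚ·1` on the path-connected `P(ℂ)`);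
`E = E₊ ⊞ Q`. Nothing is claimed about first-order liftability of `E`; HC is not proved.
[cite: Fulton1998, Example 3.2.3, §15.1 and Example 15.2.16 (b)] [cite: Hartshorne1977, II Thm. 5.17]
[cite: MumfordAV1970, §1 (3)] -/
theorem hasSeedOn_smul_of_serre_of_mem_algebraicClasses (hS : Hartshorne1977_serre_subbundleOfTwists)
    (C : ChernCharacterBetti) {n : ℕ} (𝒪 : ObjClass)
    (h𝒪 : ∀ (X₀ : SchemeOver ℂ) (I : Finset ℕ) (κ : (p : ℕ) → complexBetti X₀ (2 * p)),
      I = Finset.range (2 * n + 1) → (∃ P₀ : AbelianVariety ℂ, Nonempty (X₀ ≅ P₀.X)) →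
      (∃ (F : X₀.left.Modules) (_ : IsFiniteLocallyFree F), ∀ p ∈ I, κ p = C.ch X₀ F p) → 𝒪 (2 * n) X₀ I κ)
    {d : ℕ} (hd : 0 < d) (P : AbelianVariety ℂ) (Ψ : P ⟶ P) (hP : P.dim = 2 * n) (hsq : Ψ ≫ Ψ = -(d • 𝟙 P))
    (e : ProjectiveEmbedding P.X) (a : complexBetti (projectiveSpace e.n ℂ) 2) (w : complexBetti P.X (2 * n))
    (ha : IsRationalClass a) (ha0 : a ≠ 0) (hwW : w ∈ weilClassesOf P Ψ n d) (hwQ : IsRationalClass w)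
    (hwalg : w ∈ algebraicClasses P.X n) (hw0 : w ≠ 0) :
    ∃ w' : complexBetti P.X (2 * n), w' ∈ weilClassesOf P Ψ n d ∧ IsRationalClass w' ∧ w' ≠ 0 ∧
      HasSeedOn 𝒪 n P ((d : ℂ) • complexBetti.map e.ι 2 a + complexBetti.map Ψ.hom.hom.hom 2 (complexBetti.map e.ι 2 a)) w' := by
  classical
  set η := complexBetti.map e.ι 2 a with hη
  set h := (d : ℂ) • η + complexBetti.map Ψ.hom.hom.hom 2 η with hh
  have hX : IsSmoothProjective (2 * n) P.X := isSmoothProjective_of_dim_eq' hP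
  haveI : Module.Finite ℂ (complexBetti P.X (2 * n)) := finite_complexBetti_abelianVariety P (2 * n)
  haveI : PathConnectedSpace (ComplexPoints P.X) := pathConnectedSpace_complexPoints_of_isSmoothProjective hX
  -- STEP 2: `w` is a RATIONAL combination of `chₙ` of vector bundles
  obtain ⟨ι, _, Eb, q, hEb, hsum⟩ := C.exists_rat_combination_of_mem_algebraicClasses hX n hwQ hwalg
  have hEbf : ∀ i, IsFiniteLocallyFree (Eb i) := fun i ↦ isFiniteLocallyFree_of_isVectorBundle (hEb i)
  -- STEP 3: purification data
  obtain ⟨s, hs⟩ := exists_rat_vandermonde_delta (2 * n + 1) n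
  -- the pulled-back bundles `M (j, i) = [j+1]^* E_i` and their Chern characters
  set M : Fin (2 * n + 1) × ι → P.X.left.Modules :=
    fun u ↦ (Scheme.Modules.pullback (((u.1 : ℕ) + 1) • 𝟙 P).hom.hom.hom.left).obj (Eb u.2) with hMdef
  have hMf : ∀ u, IsFiniteLocallyFree (M u) := fun u ↦ (hEbf u.2).pullback _
  have hchM : ∀ (u : Fin (2 * n + 1) × ι) (p : ℕ),
      C.ch P.X (M u) p = ((((u.1 : ℕ) + 1 : ℕ) : ℂ) ^ (2 * p)) • C.ch P.X (Eb u.2) p :=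
    fun u p ↦ C.ch_pullback_nsmul_id P _ (Eb u.2) (hEb u.2) p
  -- integer multiplicities `z u = N · s_j · q_i`
  obtain ⟨N, z, hN, hz⟩ := exists_nat_mul_eq_intCast fun u : Fin (2 * n + 1) × ι ↦ s u.1 * q u.2
  -- KEY: `Σ_u z_u • ch_p(M u) = N • δ_{p,n} • Σ_i q_i • ch_p(E_i)` for `p ≤ 2n`
  have key : ∀ p : ℕ, p < 2 * n + 1 → ∑ u, ((z u : ℤ) : ℂ) • C.ch P.X (M u) p =
      (N : ℂ) • (((if p = n then 1 else 0 : ℚ) : ℚ) : ℂ) • ∑ i, ((q i : ℚ) : ℂ) • C.ch P.X (Eb i) p := by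
    intro p hp
    have hsp : ∑ j, s j * ((j : ℚ) + 1) ^ (2 * p) = if p = n then 1 else 0 := hs ⟨p, hp⟩
    have hcast : ∀ u : Fin (2 * n + 1) × ι, ((z u : ℤ) : ℂ) = (N : ℂ) * ((s u.1 : ℚ) : ℂ) * ((q u.2 : ℚ) : ℂ) := by
      intro u
      have := hz u
      have h' : ((z u : ℤ) : ℂ) = (((z u : ℤ) : ℚ) : ℂ) := by norm_cast
      rw [h', this]; push_cast; ring
    calc ∑ u, ((z u : ℤ) : ℂ) • C.ch P.X (M u) p
        = ∑ u : Fin (2 * n + 1) × ι, ((N : ℂ) * ((q u.2 : ℚ) : ℂ) *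
            (((s u.1 : ℚ) : ℂ) * ((((u.1 : ℕ) + 1 : ℕ) : ℂ) ^ (2 * p)))) • C.ch P.X (Eb u.2) p :=
          Finset.sum_congr rfl fun u _ ↦ by rw [hchM, hcast, smul_smul]; ring_nf
      _ = ∑ i, ∑ j : Fin (2 * n + 1), ((N : ℂ) * ((q i : ℚ) : ℂ) *
            (((s j : ℚ) : ℂ) * ((((j : ℕ) + 1 : ℕ) : ℂ) ^ (2 * p)))) • C.ch P.X (Eb i) p := by
          rw [Fintype.sum_prod_type, Finset.sum_comm]
      _ = ∑ i, ((N : ℂ) * ((q i : ℚ) : ℂ) * ∑ j : Fin (2 * n + 1), ((s j : ℚ) : ℂ) * ((((j : ℕ) + 1 : ℕ) : ℂ) ^ (2 * p))) •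
            C.ch P.X (Eb i) p := by
          refine Finset.sum_congr rfl fun i _ ↦ ?_
          rw [← Finset.sum_smul, Finset.mul_sum]
      _ = (N : ℂ) • (((if p = n then 1 else 0 : ℚ) : ℚ) : ℂ) • ∑ i, ((q i : ℚ) : ℂ) • C.ch P.X (Eb i) p := by
          have hsumC : ∑ j : Fin (2 * n + 1), ((s j : ℚ) : ℂ) * ((((j : ℕ) + 1 : ℕ) : ℂ) ^ (2 * p)) =
              (((if p = n then 1 else 0 : ℚ) : ℚ) : ℂ) := by
            rw [← hsp]; push_cast; rfl
          rw [Finset.smul_sum, Finset.smul_sum]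
          refine Finset.sum_congr rfl fun i _ ↦ ?_
          rw [hsumC, smul_smul, smul_smul]
          ring_nf
  -- the lists `L±` and the direct sums `E± = foldr ⊞ Z L±`
  set Z : P.X.left.Modules := SheafOfModules.free (R := P.X.left.ringCatSheaf) PUnit with hZdef
  have hZf : IsFiniteLocallyFree Z := Literature.AlgebraicGeometry.KTheory.KZero.isFiniteLocallyFree_free PUnit
  set Lp : List P.X.left.Modules :=
    (Finset.univ : Finset (Fin (2 * n + 1) × ι)).toList.flatMap fun u ↦ List.replicate (z u).toNat (M u) with hLp
  set Lm : List P.X.left.Modules :=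
    (Finset.univ : Finset (Fin (2 * n + 1) × ι)).toList.flatMap fun u ↦ List.replicate (-z u).toNat (M u) with hLm
  have hLpf : ∀ F ∈ Lp, IsFiniteLocallyFree F := by
    intro F hF
    simp only [hLp, List.mem_flatMap, List.mem_replicate] at hF
    obtain ⟨u, -, -, rfl⟩ := hF
    exact hMf u
  have hLmf : ∀ F ∈ Lm, IsFiniteLocallyFree F := by
    intro F hF
    simp only [hLm, List.mem_flatMap, List.mem_replicate] at hF
    obtain ⟨u, -, -, rfl⟩ := hF
    exact hMf u
  have hEpf : IsFiniteLocallyFree (Lp.foldr (· ⊞ ·) Z) := isFiniteLocallyFree_foldr_biprod hZf Lp hLpf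
  have hEmf : IsFiniteLocallyFree (Lm.foldr (· ⊞ ·) Z) := isFiniteLocallyFree_foldr_biprod hZf Lm hLmf
  have hchEp : ∀ p, C.ch P.X (Lp.foldr (· ⊞ ·) Z) p = ∑ u, (z u).toNat • C.ch P.X (M u) p + C.ch P.X Z p := by
    intro p
    rw [C.ch_foldr_biprod hZf p Lp hLpf, hLp, sum_map_flatMap_replicate, Finset.sum_map_toList]
  have hchEm : ∀ p, C.ch P.X (Lm.foldr (· ⊞ ·) Z) p = ∑ u, (-z u).toNat • C.ch P.X (M u) p + C.ch P.X Z p := by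
    intro p
    rw [C.ch_foldr_biprod hZf p Lm hLmf, hLm, sum_map_flatMap_replicate, Finset.sum_map_toList]
  -- STEP 4: the `K`-symmetrised re-embedding and SERRE on `E₋`
  obtain ⟨eK, aK, μ, haK, haK0, hμ, hcl⟩ := exists_projectiveEmbedding_symmetrised hd hsq e ha ha0
  obtain ⟨L₀, hL₀, k, Q, hQ, iS, pS, wS, hSE⟩ := hS eK (Lm.foldr (· ⊞ ·) Z) hEmf
  -- additivity on `0 → E₋ → F → Q → 0` (before abbreviating `e_K^*L₀`)
  have hadd : ∀ p, C.ch P.X ((List.replicate k ((Scheme.Modules.pullback eK.ι.left).obj L₀)).foldr (· ⊞ ·)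
      ((Scheme.Modules.pullback eK.ι.left).obj L₀)) p = C.ch P.X (Lm.foldr (· ⊞ ·) Z) p + C.ch P.X Q p :=
    fun p ↦ C.ch_shortExact (ShortComplex.mk iS pS wS) hSE hEmf.isVectorBundle hQ.isVectorBundle p
  set LK : P.X.left.Modules := (Scheme.Modules.pullback eK.ι.left).obj L₀ with hLK
  have hLKf : IsFiniteLocallyFree LK := hL₀.isFiniteLocallyFree.pullback _
  have hrep : ∀ F ∈ List.replicate k LK, IsFiniteLocallyFree F := fun F hF ↦ by
    rw [List.eq_of_mem_replicate hF]; exact hLKf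
  have hchQ : ∀ p, C.ch P.X Q p =
      C.ch P.X ((List.replicate k LK).foldr (· ⊞ ·) LK) p - C.ch P.X (Lm.foldr (· ⊞ ·) Z) p := fun p ↦ by
    rw [hadd, add_sub_cancel_left]
  have hchF : ∀ p, C.ch P.X ((List.replicate k LK).foldr (· ⊞ ·) LK) p = (k + 1 : ℕ) • C.ch P.X LK p := by
    intro p
    rw [C.ch_foldr_biprod hLKf p _ hrep, List.map_replicate, List.sum_replicate, add_smul, one_smul]
  -- `ch_p(LK) ∈ ℚ·h^p` for every `p`
  have hchLK : ∀ p, ∃ ℓ : ℚ, C.ch P.X LK p = ((ℓ : ℚ) : ℂ) • cupPowTwo h p := by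
    intro p
    rcases Nat.eq_zero_or_pos p with rfl | hp
    · -- degree `0`: `H⁰(P(ℂ); ℂ) = ℂ·1`
      obtain ⟨t, ht⟩ := Literature.Topology.FourManifolds.ComplexProjectiveSpace.exists_eq_smul_one (K := ℂ)
        (C.ch P.X LK 0)
      have h1Q : IsRationalClass (singularCohomology.one ℂ (ComplexPoints P.X)) := IsIntegralClass.one.isRationalClass
      have h10 : singularCohomology.one ℂ (ComplexPoints P.X) ≠ 0 := fun h0 ↦ by
        have h1 := Literature.Topology.FourManifolds.ComplexProjectiveSpace.singularCohomologyZeroEquiv_one (K := ℂ)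
          (X := ComplexPoints P.X)
        rw [h0, map_zero] at h1
        exact zero_ne_one h1
      obtain ⟨ℓ, hℓ⟩ := exists_ratCast_eq_of_isRationalClass_smul h1Q h10 (z := t)
        (by rw [← ht]; exact C.isRationalClass_ch P.X LK hLKf.isVectorBundle 0)
      exact ⟨ℓ, by rw [ht, ← hℓ, cupPowTwo_zero]⟩
    · -- degree `p ≥ 1`: the line-bundle exponential on `ℙⁿ`, pulled back, and `ch₁(L₀) ∈ ℚ·a_K`
      obtain ⟨r₀, -, hr₀⟩ := exists_isRationalClass_forall_eq_smul_projectiveSpace eK.n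
      obtain ⟨za, hza⟩ := hr₀ aK
      obtain ⟨z1, hz1⟩ := hr₀ (C.ch _ L₀ 1)
      have hza0 : za ≠ 0 := fun h0 ↦ haK0 (by rw [hza, h0, zero_smul])
      have hc1 : C.ch _ L₀ 1 = (z1 / za) • aK := by rw [hza, smul_smul, div_mul_cancel₀ z1 hza0, ← hz1]
      obtain ⟨ℓ₁, hℓ₁⟩ := exists_ratCast_eq_of_isRationalClass_smul haK haK0 (z := z1 / za)
        (by rw [← hc1]; exact C.isRationalClass_ch _ L₀ hL₀.isVectorBundle 1)
      refine ⟨((Nat.factorial p : ℕ) : ℚ)⁻¹ * (ℓ₁ * μ) ^ p, ?_⟩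
      rw [hLK, ← C.map_ch eK.ι L₀ hL₀.isVectorBundle p, C.ch_of_hasRankLE_one hL₀ hp, map_smul,
        complexBetti_map_cupPowTwo', hc1, ← hℓ₁, map_smul]
      change _ • cupPowTwo (((ℓ₁ : ℚ) : ℂ) • complexBetti.map eK.ι 2 aK) p = _
      rw [hcl, smul_smul, cupPowTwo_smul, smul_smul]
      congr 1
      push_cast
      ring
  choose ℓ hℓ using hchLK
  -- STEP 5: the design `E = E₊ ⊞ Q` and its Chern character
  have hEf : IsFiniteLocallyFree (Lp.foldr (· ⊞ ·) Z ⊞ Q) :=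
    Literature.AlgebraicGeometry.KTheory.KZero.isFiniteLocallyFree_biprod hEpf hQ
  have hN0 : (N : ℂ) ≠ 0 := by exact_mod_cast hN.ne'
  have hchE : ∀ p, p < 2 * n + 1 → C.ch P.X (Lp.foldr (· ⊞ ·) Z ⊞ Q) p =
      ((((k + 1 : ℕ) : ℚ) * ℓ p : ℚ) : ℂ) • cupPowTwo h p +
        (N : ℂ) • (((if p = n then 1 else 0 : ℚ) : ℚ) : ℂ) • ∑ i, ((q i : ℚ) : ℂ) • C.ch P.X (Eb i) p := by
    intro p hp
    rw [C.ch_biprod _ _ hEpf.isVectorBundle hQ.isVectorBundle, hchQ, hchF, hchEp, hchEm, hℓ, ← key p hp]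
    have hzs : ∑ u, ((z u : ℤ) : ℂ) • C.ch P.X (M u) p =
        ∑ u, (z u).toNat • C.ch P.X (M u) p - ∑ u, (-z u).toNat • C.ch P.X (M u) p := by
      rw [← Finset.sum_sub_distrib]
      refine Finset.sum_congr rfl fun u _ ↦ ?_
      rw [toNat_smul_sub_neg_toNat_smul, Int.cast_smul_eq_zsmul]
    rw [hzs, ← Nat.cast_smul_eq_nsmul ℂ (k + 1)]
    push_cast
    module
  -- the seed
  have hNQ : IsRationalClass ((N : ℂ) • w) := by
    have := hwQ.smul (N : ℚ); rwa [Rat.cast_natCast] at this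
  refine ⟨(N : ℂ) • w, Submodule.smul_mem _ _ hwW, hNQ, smul_ne_zero hN0 hw0, Finset.range (2 * n + 1),
    fun p ↦ C.ch P.X (Lp.foldr (· ⊞ ·) Z ⊞ Q) p, ((k + 1 : ℕ) : ℚ) * ℓ n, fun p ↦ ((k + 1 : ℕ) : ℚ) * ℓ p,
    Finset.mem_range.2 (by omega), h𝒪 _ _ _ rfl ⟨P, ⟨Iso.refl _⟩⟩ ⟨_, hEf, fun _ _ ↦ rfl⟩, ?_, ?_⟩
  · beta_reduce
    rw [hchE n (by omega), if_pos rfl, hsum, Rat.cast_one, one_smul]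
  · intro p hpI hpn
    beta_reduce
    rw [hchE p (by simpa using hpI), if_neg hpn, Rat.cast_zero, zero_smul, smul_zero, add_zero]

end Design

/-! ## §2 The pinned PAD-4 anchor: `stub_lfDesign_pad4` and `stub_kappaDesign_pad4` of line `birthC` v2, MODULO Serre -/

section Pad4

variable {E₀ : AbelianVariety ℂ} {ψ₀ : E₀ ⟶ E₀} {d : ℕ}

/-- **THE DESIGN-ONLY STUB `stub_lfDesign_pad4` (line `birthC` v2), MODULO `Hartshorne1977_serre_subbundleOfTwists`**
(CONDITIONAL; for every object class `𝒪` containing the f.l.f. κ-designs — the skeleton's `lfDesignClass C` qualifies by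
`fun _ _ _ h₁ h₂ h₃ ↦ ⟨h₁, h₂, h₃⟩` — and the nested action `Ψ = (ψ₀ × (−ψ₀))⁴` given with its defining equation,
`pad4Action E₀ ψ₀` and `rfl` in the skeleton; the hyperbolicity hypothesis of the stub is not needed). The Weil class `w`
is algebraic AT THE ANCHOR (`pad4Anchor_hodgeClass_mem_algebraicClasses`), so `hasSeedOn_smul_of_serre_of_mem_algebraicClasses`
applies. [cite: vanGeemen1994HodgeAV, Thm. 4.3] [cite: Fulton1998, Example 15.2.16 (b)] [cite: Hartshorne1977, II Thm. 5.17] -/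
theorem lfDesign_pad4_of_serre (hS : Hartshorne1977_serre_subbundleOfTwists) (C : ChernCharacterBetti) (𝒪 : ObjClass)
    (h𝒪 : ∀ (X₀ : SchemeOver ℂ) (I : Finset ℕ) (κ : (p : ℕ) → complexBetti X₀ (2 * p)),
      I = Finset.range (2 * 4 + 1) → (∃ P₀ : AbelianVariety ℂ, Nonempty (X₀ ≅ P₀.X)) →
      (∃ (F : X₀.left.Modules) (_ : IsFiniteLocallyFree F), ∀ p ∈ I, κ p = C.ch X₀ F p) → 𝒪 (2 * 4) X₀ I κ)
    (hd : 0 < d) (hE : E₀.dim = 1) (hψ : ψ₀ ≫ ψ₀ = -(d • 𝟙 E₀))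
    (Ψ : (((E₀.prod E₀).prod (E₀.prod E₀)).prod (E₀.prod E₀)).prod (E₀.prod E₀) ⟶
      (((E₀.prod E₀).prod (E₀.prod E₀)).prod (E₀.prod E₀)).prod (E₀.prod E₀))
    (hΨ : Ψ = AbelianVariety.prodLift
        (AbelianVariety.fst (((E₀.prod E₀).prod (E₀.prod E₀)).prod (E₀.prod E₀)) (E₀.prod E₀) ≫
          AbelianVariety.prodLift
            (AbelianVariety.fst ((E₀.prod E₀).prod (E₀.prod E₀)) (E₀.prod E₀) ≫
              AbelianVariety.prodLift
                (AbelianVariety.fst (E₀.prod E₀) (E₀.prod E₀) ≫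
                  AbelianVariety.prodLift (AbelianVariety.fst E₀ E₀ ≫ ψ₀) (AbelianVariety.snd E₀ E₀ ≫ (-ψ₀)))
                (AbelianVariety.snd (E₀.prod E₀) (E₀.prod E₀) ≫
                  AbelianVariety.prodLift (AbelianVariety.fst E₀ E₀ ≫ ψ₀) (AbelianVariety.snd E₀ E₀ ≫ (-ψ₀))))
            (AbelianVariety.snd ((E₀.prod E₀).prod (E₀.prod E₀)) (E₀.prod E₀) ≫
              AbelianVariety.prodLift (AbelianVariety.fst E₀ E₀ ≫ ψ₀) (AbelianVariety.snd E₀ E₀ ≫ (-ψ₀))))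
        (AbelianVariety.snd (((E₀.prod E₀).prod (E₀.prod E₀)).prod (E₀.prod E₀)) (E₀.prod E₀) ≫
          AbelianVariety.prodLift (AbelianVariety.fst E₀ E₀ ≫ ψ₀) (AbelianVariety.snd E₀ E₀ ≫ (-ψ₀))))
    (e : ProjectiveEmbedding ((((E₀.prod E₀).prod (E₀.prod E₀)).prod (E₀.prod E₀)).prod (E₀.prod E₀)).X)
    (a : complexBetti (projectiveSpace e.n ℂ) 2)
    (w : complexBetti ((((E₀.prod E₀).prod (E₀.prod E₀)).prod (E₀.prod E₀)).prod (E₀.prod E₀)).X (2 * 4))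
    (ha : IsRationalClass a) (ha0 : a ≠ 0)
    (hwW : w ∈ weilClassesOf _ Ψ 4 d) (hwQ : IsRationalClass w)
    (hwH : IsOfHodgeType (2 * 4) ((((E₀.prod E₀).prod (E₀.prod E₀)).prod (E₀.prod E₀)).prod (E₀.prod E₀)).X (2 * 4) 4 4 w)
    (hw0 : w ≠ 0) :
    ∃ w' : complexBetti ((((E₀.prod E₀).prod (E₀.prod E₀)).prod (E₀.prod E₀)).prod (E₀.prod E₀)).X (2 * 4),
      w' ∈ weilClassesOf _ Ψ 4 d ∧ IsRationalClass w' ∧ w' ≠ 0 ∧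
      HasSeedOn 𝒪 4 ((((E₀.prod E₀).prod (E₀.prod E₀)).prod (E₀.prod E₀)).prod (E₀.prod E₀))
        ((d : ℂ) • complexBetti.map e.ι 2 a + complexBetti.map Ψ.hom.hom.hom 2 (complexBetti.map e.ι 2 a)) w' := by
  obtain ⟨hP8, hsq, -, -⟩ := pad4Anchor_hyperbolic_weilClass hE hd hψ Ψ hΨ
  exact hasSeedOn_smul_of_serre_of_mem_algebraicClasses hS C 𝒪 h𝒪 hd _ Ψ hP8 hsq e a w ha ha0 hwW hwQ
    (pad4Anchor_hodgeClass_mem_algebraicClasses hE hwQ hwH) hw0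

/-- **THE CLASS HALF `stub_kappaDesign_pad4` (line `birthC`), MODULO `Hartshorne1977_serre_subbundleOfTwists`** (CONDITIONAL):
the anchor datum `(e, a, w)` of `pad4Anchor_hyperbolic_weilClass` (hyperbolic, non-zero rational `(4,4)` Weil class) fed to
`lfDesign_pad4_of_serre` — the skeleton's `kappaDesign_pad4_of_lfDesign` in one step.
[cite: Markman2025SurveySecant, §11.5 Step 2] [cite: vanGeemen1994HodgeAV, 4.3 and 5.3] [cite: Hartshorne1977, II Thm. 5.17] -/
theorem kappaDesign_pad4_of_serre (hS : Hartshorne1977_serre_subbundleOfTwists) (C : ChernCharacterBetti) (𝒪 : ObjClass)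
    (h𝒪 : ∀ (X₀ : SchemeOver ℂ) (I : Finset ℕ) (κ : (p : ℕ) → complexBetti X₀ (2 * p)),
      I = Finset.range (2 * 4 + 1) → (∃ P₀ : AbelianVariety ℂ, Nonempty (X₀ ≅ P₀.X)) →
      (∃ (F : X₀.left.Modules) (_ : IsFiniteLocallyFree F), ∀ p ∈ I, κ p = C.ch X₀ F p) → 𝒪 (2 * 4) X₀ I κ)
    (hd : 0 < d) (hE : E₀.dim = 1) (hψ : ψ₀ ≫ ψ₀ = -(d • 𝟙 E₀))
    (Ψ : (((E₀.prod E₀).prod (E₀.prod E₀)).prod (E₀.prod E₀)).prod (E₀.prod E₀) ⟶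
      (((E₀.prod E₀).prod (E₀.prod E₀)).prod (E₀.prod E₀)).prod (E₀.prod E₀))
    (hΨ : Ψ = AbelianVariety.prodLift
        (AbelianVariety.fst (((E₀.prod E₀).prod (E₀.prod E₀)).prod (E₀.prod E₀)) (E₀.prod E₀) ≫
          AbelianVariety.prodLift
            (AbelianVariety.fst ((E₀.prod E₀).prod (E₀.prod E₀)) (E₀.prod E₀) ≫
              AbelianVariety.prodLift
                (AbelianVariety.fst (E₀.prod E₀) (E₀.prod E₀) ≫
                  AbelianVariety.prodLift (AbelianVariety.fst E₀ E₀ ≫ ψ₀) (AbelianVariety.snd E₀ E₀ ≫ (-ψ₀)))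
                (AbelianVariety.snd (E₀.prod E₀) (E₀.prod E₀) ≫
                  AbelianVariety.prodLift (AbelianVariety.fst E₀ E₀ ≫ ψ₀) (AbelianVariety.snd E₀ E₀ ≫ (-ψ₀))))
            (AbelianVariety.snd ((E₀.prod E₀).prod (E₀.prod E₀)) (E₀.prod E₀) ≫
              AbelianVariety.prodLift (AbelianVariety.fst E₀ E₀ ≫ ψ₀) (AbelianVariety.snd E₀ E₀ ≫ (-ψ₀))))
        (AbelianVariety.snd (((E₀.prod E₀).prod (E₀.prod E₀)).prod (E₀.prod E₀)) (E₀.prod E₀) ≫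
          AbelianVariety.prodLift (AbelianVariety.fst E₀ E₀ ≫ ψ₀) (AbelianVariety.snd E₀ E₀ ≫ (-ψ₀)))) :
    ∃ (e : ProjectiveEmbedding ((((E₀.prod E₀).prod (E₀.prod E₀)).prod (E₀.prod E₀)).prod (E₀.prod E₀)).X)
      (a : complexBetti (projectiveSpace e.n ℂ) 2)
      (w : complexBetti ((((E₀.prod E₀).prod (E₀.prod E₀)).prod (E₀.prod E₀)).prod (E₀.prod E₀)).X (2 * 4)),
      IsRationalClass a ∧ a ≠ 0 ∧
      IsHyperbolicWeilType _ Ψ 4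
        ((d : ℂ) • complexBetti.map e.ι 2 a + complexBetti.map Ψ.hom.hom.hom 2 (complexBetti.map e.ι 2 a)) ∧
      w ∈ weilClassesOf _ Ψ 4 d ∧ IsRationalClass w ∧ w ≠ 0 ∧
      HasSeedOn 𝒪 4 ((((E₀.prod E₀).prod (E₀.prod E₀)).prod (E₀.prod E₀)).prod (E₀.prod E₀))
        ((d : ℂ) • complexBetti.map e.ι 2 a + complexBetti.map Ψ.hom.hom.hom 2 (complexBetti.map e.ι 2 a)) w := by
  obtain ⟨-, -, ⟨e, a, ha, ha0, hhyp⟩, ⟨w, hwQ, hwH, hwW, hw0⟩⟩ := pad4Anchor_hyperbolic_weilClass hE hd hψ Ψ hΨ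
  obtain ⟨w', hw'W, hw'Q, hw'0, hseed⟩ :=
    lfDesign_pad4_of_serre hS C 𝒪 h𝒪 hd hE hψ Ψ hΨ e a w ha ha0 hwW hwQ hwH hw0
  exact ⟨e, a, w', ha, ha0, hhyp, hw'W, hw'Q, hw'0, hseed⟩

end Pad4

end Summit.HodgeConjecture.HodgeConjecture.Theorems

end
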